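import Literature.MathematicalPhysics.QuantumFieldTheory.Balaban1983to89.B6Eq2144

/-!
# `Balaban1983to89.B6Eq2144Bonds` — T. Bałaban, *Propagators and renormalization transformations for lattice gauge
# theories. II*, Commun. Math. Phys. **96** (1984) 223–250 [Balaban1984PropagatorsII], (2.144)–(2.147) p. 248 on the
# CONCRETE unit-lattice bond fields: `Q″`, `Q″*`, `B₁` on `ℓ²`, and *"‖B₁‖² is bounded from below by const‖B‖²"* ⇒ (2.147)

statement-level skeleton of published theorems with citation tags; proofs where landed; nothing here is a claim about the Yang–Mills mass gap

PDF held: `paper:balaban1984-cmp96-propagators-rt-ii` (journal page = PDF page + 222); p. 248 [PDF 26] read AS AN IMAGE on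
the ×2 render `run/shared/lean/pub/pub-balaban/b2b-balaban-ref1/pages/1984-cmp96-propagators-rt-II/…-p026-x2.png` by
this seat (2026-08-21).

CITATION HEADER (lean-in-tree rule).  WHAT IS REPRODUCED: the concrete half of lit-balaban SKELETON row **B6.Eq2.144**
(companion of this seat's `…B6Eq2144`, p246027, where (2.144)₂–(2.147) are PROVED from (2.129) over the abstract
carriers of `…B6Eq295` §4 with four hypotheses about the two-scale fields left displayed: `hQpp` (`Q″*` is the
adjoint of `Q″` *"on the unit scale"*), `hP1`/`hP2` (`B₁ = P(Q″*B)` is the projection into the configurations (2.121)),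
and `hB1` (*"‖B₁‖² is bounded from below by const‖B‖²"*)).  HERE those four hypotheses are DISCHARGED on the concrete
carriers of `…B6GaussianIdentity2119` §2 / `…B6AdjointAveraging` / `…B6BondElimination` — unit-lattice bond fields
indexed by `B4.Idx Ω d` (starting point ∈ Ω ⊂ ℤ^d, direction), two-scale fields `B = (B↾_E, B′↾_K)` on `E ⊕ K`
(`E` the identity bonds of `Λ^c`, `K` the constraint bonds of `Λ′`), both made into real inner-product spaces as
`EuclideanSpace ℝ _` (= the printed *"L²-space … with sites replaced by bonds"* on the unit scale, weights 1; the
two-scale weights of (2.69) rescale `w` and the constant, as recorded in `…B6AdjointAveraging` (d)) — and the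
concrete (2.147) `ineq2147_bonds` follows from `…B6Eq2144.ineq2147_of_2129` with
**`γ₀ = γ₁⁻¹·(2 + 2L^d + L^{2d}/w²)⁻¹`**, `w² = L^{d−2}` in print: *"a positive constant γ₀ depending on d and L only"*
(given the upper bound `γ₁` of the form (2.120)).  PHASE-2 seat p22 (gen 3); owner r03, referee ref-4.  Nothing of any
existing module is restated or modified: `qppLin`/`qpp`/`sum_mul_qppAdj` (`…B6GaussianIdentity2119`), `adjQ`/`bOne`/
`p248_lower` (`…B6AdjointAveraging`), `IsTree`/`Admissible`/`pivSite` (`…B6BondElimination`) and `ineq2147_of_2129`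
(`…B6Eq2144`) are consumed by name.

PRINT (p. 248 [PDF 26], verbatim): *"⟨B,(QG_□Q*)↾_□B⟩ = (L^jη)^{d+2}⟨B,(QG^ξ_□Q*)↾_□B⟩ = (L^jη)^{d+2}⟨Q″*B, Q_jG^ξ_□Q_j*Q″*B⟩,
(2.144) where Q″ is defined, as in (2.119), by the quadratic form in B in the expression (2.112), and the last scalar
product above is on the unit scale. We put B equal to 0 outside □ … ⟨B,QGQ*B⟩ = ⟨Q″*B, C̃^{(j)}_ΛQ″*B⟩ = ⟨B₁, C̃^{(j)}_ΛB₁⟩,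
(2.146) where B₁ is equal to Q″*B everywhere except the bonds of ⋃_{y∈Λ′}Ax(y) at which it is equal to 0. The operator
C̃^{(j)}_Λ is an inverse to the operator of the quadratic form (2.120), hence it is bounded from below by an inverse of an
upper bound of this form. Taking into account that ‖B₁‖² is bounded from below by const‖B‖², we get
⟨B,(QG_□Q*)↾_□B⟩ ≥ γ₀‖B‖² (2.147) with a positive constant γ₀ depending on d and L only."*; p. 243 after (2.119):
*"where ½⟨Q″B, aQ″B⟩ is equal to the quadratic form in B in (2.112)"* (`= ½aΣ_{b∈Λ^c}|B(b)|² + ½aL^{d−2}Σ_{c∈Λ′}|(Q₁B)(c)|²`).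

WHAT IS TYPED / PROVED (every definition has a body; no deferred proofs).
§1 the two-scale fields as ONE `ℓ²` space: `fPart`/`bPart` (the coordinates `F = B↾_E`, `B′ = B↾_K` of
   `v ∈ ℓ²(E ⊕ K)`, extended by zero), linearity, `elim_parts`, **`norm_sq_eq_parts`** (`‖v‖² = Σ_E F² + Σ_K B′²`).
§2 **`qppE`** = `Q″` on `ℓ²` (the transport of `…B6GaussianIdentity2119.qppLin`: `Q″B = (B↾_E, w·(Q₁B)↾_K)`),
   **`qppAdjE`** = `Q″*` (`Q″*(F,B′)(b) = 1_E(b)F(b) + w·(Q₁*B′)(b)`, `Q₁* = …B6AdjointAveraging.adjQ`), and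
   **`inner_qppAdjE`**: `⟨Q″*v, x⟩ = ⟨v, Q″x⟩` — the hypothesis `hQpp` of `…B6Eq2144`, from `sum_mul_qppAdj`.
§3 **`treeProj`** = *"equal to … everywhere except the bonds of ⋃_{y∈Λ′}Ax(y) at which it is equal to 0"* (the axial tree
   bonds `IsTree L Y`, = the bonds of ⋃Ax(y) by `…B6BondElimination.isTree_iff`), `treeProj_qppAdjE` (`B₁ = P(Q″*B)` IS
   `…B6AdjointAveraging.bOne`), `treeProj_idem`, **`inner_sub_treeProj`** (`⟨K − PK, Pm⟩ = 0`) — the hypotheses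
   `hP1`/`hP2` with `ι_B := treeProj` parametrising the configurations (2.121).
§4 **`hB1_bonds`** — *"‖B₁‖² is bounded from below by const‖B‖²"* in the shape `hB1` of `…B6Eq2144.ineq2147_of_2129`:
   `(2 + 2L^d + L^{2d}/w²)⁻¹‖v‖² ≤ ‖P(Q″*v)‖²` (= `p248_lower`; hypotheses as there: `K` admissible, no `E`-bond is a
   tree bond or a pivot — the repaired interface convention of `…B6AdjointAveraging` header (e)).
§5 **`ineq2147_bonds`** — (2.147) on the concrete two-scale fields: `γ₁⁻¹(2 + 2L^d + L^{2d}/w²)⁻¹‖B‖² ≤ ⟨B, QGQ*B⟩`,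
   `Q = Q″Q_j`, with the remaining data of `ineq2147_of_2129` (the fine fields `A`, `Q_j`, `G`, `G̃_j`, `H_j`, the two
   Gaussians' covariances, the gauge invariance `hgauge`, (2.129) for every source) kept abstract over `ℓ²(unit bonds)`.
READINGS.  (a) As `…B6AdjointAveraging` (a)–(e): `w` (print `L^{(d−2)/2}`) is a free non-zero real; unit-scale sums;
finite `Ω ⊂ ℤ^d` carrying all bonds in play; *"We put B equal to 0 outside □"* restricts the argument, not the
inequality.  (b) The constraint configurations (2.121) are parametrised by `ι_B := treeProj` itself (`N_B := ℓ²(unit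
bonds)`; range = the fields vanishing on the tree bonds), so `hP1` is trivial (`m := K`; `treeProj_idem` records that the range is where `P` fixes) and `hP2` is
`inner_sub_treeProj`.
(c) `γ₁`, the form/covariance data and (2.129) stay hypotheses exactly as in `…B6Eq2144` (READINGS there).
Unit `lit-balaban-p22` (PHASE-2 proof seat, gen 3), HOME `run/shared/lean/pub/lit-balaban/`, 2026-08-21.
-/

noncomputable section

open scoped InnerProductSpace
open Finset

namespace Literature.MathematicalPhysics.QuantumFieldTheory.Balaban1983to89.B6Eq2144Bonds

open B6BondElimination B6AdjointAveraging B6GaussianIdentity2119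

variable {d : ℕ} {Ω : Finset (Fin d → ℤ)}

/-- The real inner product of `EuclideanSpace ℝ ι` is the dot product of the coordinate functions. [folklore] -/
private theorem inner_eq_dot {ι : Type*} [Fintype ι] (x y : EuclideanSpace ℝ ι) :
    ⟪x, y⟫_ℝ = WithLp.ofLp x ⬝ᵥ WithLp.ofLp y := by
  rw [EuclideanSpace.inner_eq_star_dotProduct, star_trivial, dotProduct_comm]

/-! ## §1 Two-scale fields `B = (B↾_E, B′↾_K)` as one `ℓ²` space -/

section Parts

variable (E : Finset (B4.Idx Ω d)) (K : Finset ((Fin d → ℤ) × Fin d))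

/-- The identity part `F = B↾_E` of a two-scale field `v ∈ ℓ²(E ⊕ K)`, as a unit-bond field extended by zero off `E`
(print: the bonds of `Λ^c`, first sum of the form in (2.112)). [cite: Balaban1984PropagatorsII, (2.112) + (2.119) p.243] -/
def fPart (v : EuclideanSpace ℝ (↥E ⊕ ↥K)) : B4.Idx Ω d → ℝ :=
  fun p => if h : p ∈ E then v (Sum.inl ⟨p, h⟩) else 0

/-- The coarse part `B′ = B↾_K` of a two-scale field `v ∈ ℓ²(E ⊕ K)`, as a function on the bonds of the `L`-lattice
extended by zero off `K` (print: the bonds of `Λ′`, second sum of the form in (2.112)). [cite: Balaban1984PropagatorsII, (2.112) + (2.119) p.243] -/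
def bPart (v : EuclideanSpace ℝ (↥E ⊕ ↥K)) : (Fin d → ℤ) × Fin d → ℝ :=
  fun c => if h : c ∈ K then v (Sum.inr ⟨c, h⟩) else 0

variable {E K}

/-- `F(b) = v(b)` on `E`. [cite: Balaban1984PropagatorsII, (2.119) p.243] -/
theorem fPart_of_mem (v : EuclideanSpace ℝ (↥E ⊕ ↥K)) {p : B4.Idx Ω d} (hp : p ∈ E) :
    fPart E K v p = v (Sum.inl ⟨p, hp⟩) := dif_pos hp

/-- `F = 0` off `E`. [cite: Balaban1984PropagatorsII, (2.119) p.243] -/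
theorem fPart_of_not_mem (v : EuclideanSpace ℝ (↥E ⊕ ↥K)) {p : B4.Idx Ω d} (hp : p ∉ E) : fPart E K v p = 0 :=
  dif_neg hp

/-- `B′(c) = v(c)` on `K`. [cite: Balaban1984PropagatorsII, (2.119) p.243] -/
theorem bPart_of_mem (v : EuclideanSpace ℝ (↥E ⊕ ↥K)) {c : (Fin d → ℤ) × Fin d} (hc : c ∈ K) :
    bPart E K v c = v (Sum.inr ⟨c, hc⟩) := dif_pos hc

/-- `B′ = 0` off `K`. [cite: Balaban1984PropagatorsII, (2.119) p.243] -/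
theorem bPart_of_not_mem (v : EuclideanSpace ℝ (↥E ⊕ ↥K)) {c : (Fin d → ℤ) × Fin d} (hc : c ∉ K) :
    bPart E K v c = 0 := dif_neg hc

/-- `F` is additive in `v`. [folklore] -/
private theorem fPart_add (u v : EuclideanSpace ℝ (↥E ⊕ ↥K)) : fPart E K (u + v) = fPart E K u + fPart E K v := by
  funext p
  by_cases hp : p ∈ E
  · simp only [Pi.add_apply, fPart_of_mem _ hp, PiLp.add_apply]
  · simp only [Pi.add_apply, fPart_of_not_mem _ hp, add_zero]

/-- `F` is homogeneous in `v`. [folklore] -/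
private theorem fPart_smul (r : ℝ) (v : EuclideanSpace ℝ (↥E ⊕ ↥K)) : fPart E K (r • v) = r • fPart E K v := by
  funext p
  by_cases hp : p ∈ E
  · simp only [Pi.smul_apply, fPart_of_mem _ hp, PiLp.smul_apply]
  · simp only [Pi.smul_apply, fPart_of_not_mem _ hp, smul_eq_mul, mul_zero]

/-- `B′` is additive in `v`. [folklore] -/
private theorem bPart_add (u v : EuclideanSpace ℝ (↥E ⊕ ↥K)) : bPart E K (u + v) = bPart E K u + bPart E K v := by
  funext c
  by_cases hc : c ∈ K
  · simp only [Pi.add_apply, bPart_of_mem _ hc, PiLp.add_apply]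
  · simp only [Pi.add_apply, bPart_of_not_mem _ hc, add_zero]

/-- `B′` is homogeneous in `v`. [folklore] -/
private theorem bPart_smul (r : ℝ) (v : EuclideanSpace ℝ (↥E ⊕ ↥K)) : bPart E K (r • v) = r • bPart E K v := by
  funext c
  by_cases hc : c ∈ K
  · simp only [Pi.smul_apply, bPart_of_mem _ hc, PiLp.smul_apply]
  · simp only [Pi.smul_apply, bPart_of_not_mem _ hc, smul_eq_mul, mul_zero]

/-- The coordinates `(F↾_E, B′↾_K)` ARE the two-scale field `v`. [cite: Balaban1984PropagatorsII, (2.119) p.243] -/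
theorem elim_parts (v : EuclideanSpace ℝ (↥E ⊕ ↥K)) :
    Sum.elim (fun b : ↥E => fPart E K v b) (fun c : ↥K => bPart E K v c) = WithLp.ofLp v := by
  funext i
  cases i with
  | inl b => simp only [Sum.elim_inl, fPart_of_mem v b.2, Subtype.coe_eta]
  | inr c => simp only [Sum.elim_inr, bPart_of_mem v c.2, Subtype.coe_eta]

/-- **`‖B‖² = Σ_{b∈E}|F(b)|² + Σ_{c∈K}|B′(c)|²`** — the unit-scale norm of the two-scale field (print: the `‖B‖²` of
(2.147)). [cite: Balaban1984PropagatorsII, (2.147) p.248] -/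
theorem norm_sq_eq_parts (v : EuclideanSpace ℝ (↥E ⊕ ↥K)) :
    ‖v‖ ^ 2 = ∑ p ∈ E, fPart E K v p ^ 2 + ∑ c ∈ K, bPart E K v c ^ 2 := by
  rw [EuclideanSpace.norm_sq_eq, Fintype.sum_sum_type, ← Finset.sum_coe_sort E (fun p => fPart E K v p ^ 2),
    ← Finset.sum_coe_sort K (fun c => bPart E K v c ^ 2)]
  congr 1
  · refine Finset.sum_congr rfl fun b _ => ?_
    rw [Real.norm_eq_abs, sq_abs, fPart_of_mem v b.2]
  · refine Finset.sum_congr rfl fun c _ => ?_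
    rw [Real.norm_eq_abs, sq_abs, bPart_of_mem v c.2]

end Parts

/-! ## §2 `Q″` and its adjoint `Q″*` on `ℓ²` -/

section Qpp

variable (E : Finset (B4.Idx Ω d)) (K : Finset ((Fin d → ℤ) × Fin d)) (L : ℕ) (w : ℝ)

/-- **`Q″` on `ℓ²`** — *"Q″ is defined, as in (2.119), by the quadratic form in B in the expression (2.112)"*:
`Q″B = (B↾_E, w·(Q₁B)↾_K)`, the transport to `EuclideanSpace` of `…B6GaussianIdentity2119.qppLin` (`w² = L^{d−2}` in
print). [cite: Balaban1984PropagatorsII, (2.119) p.243 + (2.144) p.248] -/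
def qppE : EuclideanSpace ℝ (B4.Idx Ω d) →ₗ[ℝ] EuclideanSpace ℝ (↥E ⊕ ↥K) where
  toFun x := WithLp.toLp 2 (qppLin L E K w (WithLp.ofLp x))
  map_add' x y := by
    rw [WithLp.ofLp_add, map_add, WithLp.toLp_add]
  map_smul' r x := by
    rw [RingHom.id_apply, WithLp.ofLp_smul, map_smul, WithLp.toLp_smul]

/-- `Q″x` in coordinates is `qpp`. [cite: Balaban1984PropagatorsII, (2.119) p.243] -/
@[simp] theorem ofLp_qppE (x : EuclideanSpace ℝ (B4.Idx Ω d)) :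
    WithLp.ofLp (qppE E K L w x) = qpp L E K w (WithLp.ofLp x) := rfl

/-- `Q₁*` is additive. [cite: Balaban1984PropagatorsI, (1.11) p.19] -/
theorem adjQ_add (B' B'' : (Fin d → ℤ) × Fin d → ℝ) (p : B4.Idx Ω d) :
    adjQ L K (B' + B'') p = adjQ L K B' p + adjQ L K B'' p := by
  simp only [adjQ, Pi.add_apply, mul_add, Finset.sum_add_distrib]

/-- `Q₁*` is homogeneous. [cite: Balaban1984PropagatorsI, (1.11) p.19] -/
theorem adjQ_smul (r : ℝ) (B' : (Fin d → ℤ) × Fin d → ℝ) (p : B4.Idx Ω d) :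
    adjQ L K (r • B') p = r * adjQ L K B' p := by
  simp only [adjQ, Pi.smul_apply, smul_eq_mul, Finset.mul_sum]
  exact Finset.sum_congr rfl fun c _ => by ring

/-- **`Q″*` on `ℓ²`**: `Q″*(F, B′)(b) = 1_E(b)F(b) + w·(Q₁*B′)(b)`, `Q₁* = …B6AdjointAveraging.adjQ` the adjoint of the
block averaging (1.11) of [Balaban1984PropagatorsI]. [cite: Balaban1984PropagatorsII, (2.144)–(2.146) p.248] -/
def qppAdjE : EuclideanSpace ℝ (↥E ⊕ ↥K) →ₗ[ℝ] EuclideanSpace ℝ (B4.Idx Ω d) where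
  toFun v := WithLp.toLp 2 fun p => (if p ∈ E then fPart E K v p else 0) + w * adjQ L K (bPart E K v) p
  map_add' u v := by
    ext p
    simp only [PiLp.add_apply, fPart_add, bPart_add, Pi.add_apply, adjQ_add, mul_add]
    split_ifs <;> ring
  map_smul' r v := by
    ext p
    simp only [PiLp.smul_apply, RingHom.id_apply, fPart_smul, bPart_smul, Pi.smul_apply, smul_eq_mul, adjQ_smul]
    split_ifs <;> ring

/-- `Q″*v` at a unit bond. [cite: Balaban1984PropagatorsII, (2.146) p.248] -/
theorem qppAdjE_apply (v : EuclideanSpace ℝ (↥E ⊕ ↥K)) (p : B4.Idx Ω d) :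
    qppAdjE E K L w v p = (if p ∈ E then fPart E K v p else 0) + w * adjQ L K (bPart E K v) p := rfl

/-- **`Q″*` IS the adjoint of `Q″` for the unit-scale scalar products** (*"the last scalar product above is on the unit
scale"*): `⟨Q″*v, x⟩ = ⟨v, Q″x⟩` — the hypothesis `hQpp` of `…B6Eq2144`, from `…B6GaussianIdentity2119.sum_mul_qppAdj`.
[cite: Balaban1984PropagatorsII, (2.144) p.248] -/
theorem inner_qppAdjE (v : EuclideanSpace ℝ (↥E ⊕ ↥K)) (x : EuclideanSpace ℝ (B4.Idx Ω d)) :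
    ⟪qppAdjE E K L w v, x⟫_ℝ = ⟪v, qppE E K L w x⟫_ℝ := by
  rw [inner_eq_dot, inner_eq_dot, dotProduct_comm (WithLp.ofLp (qppAdjE E K L w v)), ofLp_qppE,
    dotProduct_comm (WithLp.ofLp v), ← elim_parts v,
    ← sum_mul_qppAdj (L := L) (E := E) (K := K) (w := w) (WithLp.ofLp x) (fPart E K v) (bPart E K v)]
  rfl

end Qpp

/-! ## §3 `B₁`: "equal to Q″*B everywhere except the bonds of ⋃_{y∈Λ′}Ax(y) at which it is equal to 0" -/

section Tree

variable (L : ℕ) (Y : Finset (Fin d → ℤ))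

/-- The projection `P` setting a unit-bond field to `0` on the axial tree bonds `IsTree L Y` (= the bonds of
`⋃_{y∈Y}Ax(y)`, `…B6BondElimination.isTree_iff`; print `Y = Λ′`): `B₁ = P(Q″*B)`.  Its range = the configurations
(2.121) *"B(b) = 0 for b ⊂ Γ_{y,x}, x ∈ B(y), y ∈ Λ′"*. [cite: Balaban1984PropagatorsII, (2.121) p.244 + (2.146) p.248] -/
def treeProj : EuclideanSpace ℝ (B4.Idx Ω d) →ₗ[ℝ] EuclideanSpace ℝ (B4.Idx Ω d) where
  toFun x := WithLp.toLp 2 fun p => if IsTree L Y p then 0 else x p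
  map_add' x y := by
    ext p
    simp only [PiLp.add_apply]
    split_ifs
    · exact (add_zero 0).symm
    · rfl
  map_smul' r x := by
    ext p
    simp only [PiLp.smul_apply, RingHom.id_apply, smul_eq_mul]
    split_ifs
    · exact (mul_zero r).symm
    · rfl

/-- `(Px)(b) = 0` on a tree bond, `= x(b)` otherwise. [cite: Balaban1984PropagatorsII, (2.146) p.248] -/
theorem treeProj_apply (x : EuclideanSpace ℝ (B4.Idx Ω d)) (p : B4.Idx Ω d) :
    treeProj L Y x p = if IsTree L Y p then 0 else x p := rfl

/-- `P` is idempotent: its range is where it fixes (the hypothesis `hP1` of `…B6Eq2144` with `ι_B := P`).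
[cite: Balaban1984PropagatorsII, (2.146) p.248] -/
theorem treeProj_idem (x : EuclideanSpace ℝ (B4.Idx Ω d)) : treeProj L Y (treeProj L Y x) = treeProj L Y x := by
  ext p
  simp only [treeProj_apply]
  split_ifs <;> rfl

/-- `K − PK` is orthogonal to the range of `P` (the hypothesis `hP2` of `…B6Eq2144` with `ι_B := P`): `K − PK` lives on
the tree bonds, `Pm` off them. [cite: Balaban1984PropagatorsII, (2.146) p.248] -/
theorem inner_sub_treeProj (x m : EuclideanSpace ℝ (B4.Idx Ω d)) :
    ⟪x - treeProj L Y x, treeProj L Y m⟫_ℝ = 0 := by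
  rw [inner_eq_dot, dotProduct]
  refine Finset.sum_eq_zero fun p _ => ?_
  rw [WithLp.ofLp_sub, Pi.sub_apply]
  change (x p - treeProj L Y x p) * treeProj L Y m p = 0
  rw [treeProj_apply, treeProj_apply]
  split_ifs
  · rw [mul_zero]
  · rw [sub_self, zero_mul]

variable (E : Finset (B4.Idx Ω d)) (K : Finset ((Fin d → ℤ) × Fin d)) (w : ℝ)

/-- **`B₁ = P(Q″*B)` IS `…B6AdjointAveraging.bOne`** (the object whose lower bound is `p248_lower`).
[cite: Balaban1984PropagatorsII, (2.146) p.248] -/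
theorem treeProj_qppAdjE (v : EuclideanSpace ℝ (↥E ⊕ ↥K)) (p : B4.Idx Ω d) :
    treeProj L Y (qppAdjE E K L w v) p = bOne L K Y E w (fPart E K v) (bPart E K v) p := rfl

/-- `‖B₁‖² = Σ_b B₁(b)²`. [cite: Balaban1984PropagatorsII, (2.146)–(2.147) p.248] -/
theorem norm_sq_treeProj_qppAdjE (v : EuclideanSpace ℝ (↥E ⊕ ↥K)) :
    ‖treeProj L Y (qppAdjE E K L w v)‖ ^ 2 = ∑ p : B4.Idx Ω d, bOne L K Y E w (fPart E K v) (bPart E K v) p ^ 2 := by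
  rw [EuclideanSpace.norm_sq_eq]
  refine Finset.sum_congr rfl fun p _ => ?_
  rw [Real.norm_eq_abs, sq_abs, treeProj_qppAdjE]

end Tree

/-! ## §4 "Taking into account that ‖B₁‖² is bounded from below by const‖B‖²" -/

section B1

variable {E : Finset (B4.Idx Ω d)} {K : Finset ((Fin d → ℤ) × Fin d)} {L : ℕ} {Y : Finset (Fin d → ℤ)} {w : ℝ}

/-- **p. 248: *"‖B₁‖² is bounded from below by const‖B‖²"*** in the shape `hB1` of `…B6Eq2144.ineq2147_of_2129`:
`(2 + 2L^d + L^{2d}/w²)⁻¹‖v‖² ≤ ‖P(Q″*v)‖²` for every two-scale field `v = (F↾_E, B′↾_K)` — `…B6AdjointAveraging.p248_lower`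
(hypotheses as there: `L > 0`, `K` admissible, no `E`-bond is a tree bond or a pivot — the repaired interface
convention of that module's header (e) —, `w ≠ 0`). [cite: Balaban1984PropagatorsII, (2.146)–(2.147) p.248] -/
theorem hB1_bonds (hL : 0 < L) (hK : Admissible L Ω K) (hEt : ∀ p ∈ E, ¬ IsTree L Y p)
    (hEp : ∀ p ∈ E, ∀ c ∈ K, (p.1 : Fin d → ℤ) = pivSite L c → p.2 ≠ c.2) (hw : w ≠ 0)
    (v : EuclideanSpace ℝ (↥E ⊕ ↥K)) :
    (2 + 2 * (L : ℝ) ^ d + (L : ℝ) ^ (2 * d) / w ^ 2)⁻¹ * ‖v‖ ^ 2 ≤ ‖treeProj L Y (qppAdjE E K L w v)‖ ^ 2 := by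
  have h := p248_lower (Y := Y) hL hK hEt hEp hw (fPart E K v) (bPart E K v)
  rw [← norm_sq_eq_parts, ← norm_sq_treeProj_qppAdjE] at h
  have hC : 0 < 2 + 2 * (L : ℝ) ^ d + (L : ℝ) ^ (2 * d) / w ^ 2 := by positivity
  rw [inv_mul_le_iff₀ hC]
  exact h

end B1

/-! ## §5 (2.147) on the concrete two-scale bond fields -/

section Concrete

variable {A : Type*} [NormedAddCommGroup A] [InnerProductSpace ℝ A]
variable {Om : Type*} [NormedAddCommGroup Om] [InnerProductSpace ℝ Om]
variable {NO : Type*} [AddCommGroup NO] [Module ℝ NO]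
variable {E : Finset (B4.Idx Ω d)} {K : Finset ((Fin d → ℤ) × Fin d)} {L : ℕ} {Y : Finset (Fin d → ℤ)} {w : ℝ}

/-- **(2.147) p. 248 on the concrete carriers: `⟨B, QGQ*B⟩ ≥ γ₀‖B‖²` with `γ₀ = γ₁⁻¹(2 + 2L^d + L^{2d}/w²)⁻¹`** —
*"a positive constant γ₀ depending on d and L only"* (`w² = L^{d−2}`; `γ₁` = *"an upper bound of this form"* (2.120)).
`= …B6Eq2144.ineq2147_of_2129` with the two-scale fields `ℓ²(E ⊕ K)`, the unit-bond fields `ℓ²(B4.Idx Ω d)`,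
`Q″ = qppE`, `Q″* = qppAdjE` (`hQpp` := `inner_qppAdjE`), the configurations (2.121) parametrised by `ι_B := treeProj`
(`hP1` trivial with `m := K`, `hP2` := `inner_sub_treeProj`) and `hB1` := `hB1_bonds`; the fine fields `A`, `Q_j`/`Q_j*`,
`G`, `G̃_j`, `H_j`/`H_j*`, the ω-Gaussian data with the gauge invariance `hgauge`, the form `M_B`/covariance `C̃^{(j)}_Λ`
of the B-Gaussian and (2.129) for every source stay displayed hypotheses. [cite: Balaban1984PropagatorsII, (2.147) p.248] -/
theorem ineq2147_bonds (hL : 0 < L) (hK : Admissible L Ω K) (hEt : ∀ p ∈ E, ¬ IsTree L Y p)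
    (hEp : ∀ p ∈ E, ∀ c ∈ K, (p.1 : Fin d → ℤ) = pivSite L c → p.2 ≠ c.2) (hw : w ≠ 0)
    (ιO : NO →ₗ[ℝ] Om) (TO : Om →ₗ[ℝ] NO) (MO Cp : Om →ₗ[ℝ] Om) (γO : ℝ) (hγO : 0 < γO)
    (hcoerO : ∀ m : NO, γO * ‖ιO m‖ ^ 2 ≤ ⟪ιO m, MO (ιO m)⟫_ℝ) (hCp : ∀ v, Cp v = ιO (TO v))
    (hsolO : ∀ (m : NO) (v : Om), ⟪ιO m, MO (Cp v)⟫_ℝ = ⟪ιO m, v⟫_ℝ)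
    (Vv : A →ₗ[ℝ] Om) (DH D₁ D₂ : Om →ₗ[ℝ] A) (hV : ∀ (o : Om) (J : A), ⟪o, Vv J⟫_ℝ = ⟪DH o, J⟫_ℝ)
    (G Gt : A →ₗ[ℝ] A) (Hj : EuclideanSpace ℝ (B4.Idx Ω d) →ₗ[ℝ] A) (Hjs : A →ₗ[ℝ] EuclideanSpace ℝ (B4.Idx Ω d))
    (hadj : ∀ (b : EuclideanSpace ℝ (B4.Idx Ω d)) (x : A), ⟪Hj b, x⟫_ℝ = ⟪b, Hjs x⟫_ℝ)
    (Qj : A →ₗ[ℝ] EuclideanSpace ℝ (B4.Idx Ω d)) (Qjs : EuclideanSpace ℝ (B4.Idx Ω d) →ₗ[ℝ] A)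
    (hQj : ∀ (b : EuclideanSpace ℝ (B4.Idx Ω d)) (v : A), ⟪Qjs b, v⟫_ℝ = ⟪b, Qj v⟫_ℝ)
    (hQGt : ∀ x : A, Qj (Gt x) = 0) (hQH : ∀ b, Qj (Hj b) = b)
    (hgauge : ∀ m : NO, (qppE E K L w ∘ₗ Qj) (DH (ιO m)) = 0)
    (TB : EuclideanSpace ℝ (B4.Idx Ω d) →ₗ[ℝ] EuclideanSpace ℝ (B4.Idx Ω d))
    (MB Ct : EuclideanSpace ℝ (B4.Idx Ω d) →ₗ[ℝ] EuclideanSpace ℝ (B4.Idx Ω d)) (γ₁ : ℝ) (hγ₁ : 0 < γ₁)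
    (hMB : ∀ x y, ⟪MB x, y⟫_ℝ = ⟪x, MB y⟫_ℝ) (hpos : ∀ m, 0 ≤ ⟪treeProj L Y m, MB (treeProj L Y m)⟫_ℝ)
    (hupper : ∀ m, ⟪treeProj L Y m, MB (treeProj L Y m)⟫_ℝ ≤ γ₁ * ‖treeProj L Y m‖ ^ 2)
    (hCt : ∀ x, Ct x = treeProj L Y (TB x))
    (hCsol : ∀ m x, ⟪treeProj L Y m, MB (Ct x)⟫_ℝ = ⟪treeProj L Y m, x⟫_ℝ)
    (h2129 : ∀ J : A, ⟪J, G J⟫_ℝ = ⟪J, (D₁ ∘ₗ Cp ∘ₗ Vv) J⟫_ℝ +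
      ⟪J - (D₂ ∘ₗ Cp ∘ₗ Vv) J, (Gt + Hj ∘ₗ Ct ∘ₗ Hjs) (J - (D₂ ∘ₗ Cp ∘ₗ Vv) J)⟫_ℝ)
    (B : EuclideanSpace ℝ (↥E ⊕ ↥K)) :
    γ₁⁻¹ * (2 + 2 * (L : ℝ) ^ d + (L : ℝ) ^ (2 * d) / w ^ 2)⁻¹ * ‖B‖ ^ 2 ≤
      ⟪B, (qppE E K L w ∘ₗ Qj) (G ((Qjs ∘ₗ qppAdjE E K L w) B))⟫_ℝ :=
  B6Eq2144.ineq2147_of_2129 ιO TO MO Cp γO hγO hcoerO hCp hsolO Vv DH D₁ D₂ hV G Gt Hj Hjs hadj Qj Qjs hQj hQGt hQH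
    (qppE E K L w) (qppAdjE E K L w) (inner_qppAdjE E K L w) hgauge (treeProj L Y) TB MB Ct γ₁ hγ₁ hMB hpos hupper
    hCt hCsol (treeProj L Y) (fun x => ⟨x, rfl⟩) (inner_sub_treeProj L Y) _
    (hB1_bonds hL hK hEt hEp hw) h2129 B

end Concrete

end Literature.MathematicalPhysics.QuantumFieldTheory.Balaban1983to89.B6Eq2144Bonds

end
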